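import Summits.QuantumFields.YangMills.Theorems.ForcedResponseSkewnessFemtoEngineFinePin
import Summits.QuantumFields.YangMills.Theorems.ForcedResponseSkewnessResponseLocalisationFarCluster
import HarnessLib

/-!
# Route `ForcedResponseSkewness`: hyperscaling clustering = femto boundary law + gap-class clustering («collar first, cluster second»)
# (lead `ym-line-frs-p1` g7, 2026-08-28)

Helper file (`--supports stmt-QuantumFields-26871`, also serves 24275), sequel of `…FemtoEngineFinePin.lean`.

The IR-light conjunct `HyperscalingClustering G r u` of the route's debt (`FemtoEngineHCSigR`) is NOT a new kind of input: it is the femto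
boundary law `FBL G r u` (E0′, an ENGINE output: the collars supply the hyperscaling prefactor `(2C₁/R⁴)²` with `R ≍ ℓ₁/u`, i.e. `≍ u⁸`) plus the
GAP-CLASS torus clustering hypothesis already used by this route for the residual's far-field clause (`Far.far_ceiling_of_fbl_clustering`,
`…FarOfClustering.lean`): bounded continuous cylinder observables with supports torus-separated by `n` have covariance `≤ K‖P‖‖Q‖e^{−m·uβ·n}`.

* `torusCov_eq_torusE_collar` — the explicit collar identity for the PAIR: `torusCov β L x y = E_T[h_x h_y]` (`h_w = γ_{B_w}(dens_w) − E_T dens_w`;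
  `Far.integral_prod_collar_eq` with `n = 2`, `torusMoment_two`);
* `abs_torusCov_le_of_collar_cluster` — at one `(β, L)`: FBL at `β` and the clustering inequality give
  `|torusCov β L x y| ≤ K·(2C₁/R⁴)²·e^{−m·uβ·n}` for `x, y` separated by `n + 2R + 4` in one coordinate (mirror of
  `Far.abs_torusK3_le_of_collar_cluster`);
* `exists_coord_half_le_valMinAbs` — some coordinate carries half the torus distance;
* **`hyperscalingClustering_of_fbl_clustering`** — `FBL G r u` ∧ (torus clustering in the unit `u`) ⇒ `HyperscalingClustering G r u`
  (radius `R = ⌊ℓ₁/(8uβ)⌋`, so `(2C₁/R⁴)²·d⁸ ≲ (u d)⁸` and `e^{−m uβ n} ≲ e^{−m·(u d)/2}`: `d⁸|torusCov| ≤ K₀·s⁸e^{−ms/2}`, `s = u(β)·d ≥ D`);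
* **`femtoEngineSigR_of_engine_clustering`** — ∀ `(G, r)` ∃ `u`: `FemtoEngineAt G r u` ∧ (torus clustering in `u`) ⇒ `FemtoEngineSigR`.

NET: the route's declared debt outside the residual is the ENGINE (`FemtoEngineAt`, one unit per `(G, r)`) plus the SAME gap-class clustering
hypothesis in that unit that already conditions the residual's far clause — nothing else.  HONEST LABEL: analysis/bookkeeping on a conditional rung
line (leaf R2a `BalabanLadder.NT`); the engine laws, the clustering (gap class), the cruxes, the residual, NT and the YM mass gap are NOT proved.
-/

set_option autoImplicit false

noncomputable section

namespace Summit.QuantumFields.YangMills.Cruxes.ResponseLocalisation.FemtoEngine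

open scoped SchwartzMap
open MeasureTheory Filter Topology Set Metric
open Literature.MathematicalPhysics.QuantumFieldTheory Literature.MathematicalPhysics.QuantumLattice
open Literature.Probability.LatticeModels
open Summit.QuantumFields.YangMills.Cruxes.OSLegsFromFemtoAndGap.DlrCollarTransfer
open Summit.QuantumFields.YangMills.Theorems.OSLegsFromFemtoAndGap (torusMoment torusMoment_two torusE_dens_eq_wilsonTorusMean)
open Summit.QuantumFields.YangMills.Cruxes.ResponseLocalisation.Birth
open Summit.QuantumFields.YangMills.Cruxes.RunningCouplingCeiling.Pointwise
open Summit.QuantumFields.YangMills.Cruxes.ResponseLocalisation.Far (integral_prod_collar_eq abs_collar_le isCylinder_collar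
  near_of_mem_collarSupport continuous_collar torusE_collar_eq_zero le_abs_valMinAbs_of_near)
open Summit.QuantumFields.YangMills.Cruxes.NT.BoundaryLaw (fbl6_of_oscillation)

variable (G : Type) [Group G] [TopologicalSpace G] [IsTopologicalGroup G] [CompactSpace G]
  [MeasurableSpace G] [BorelSpace G] (r : LatticeRep G)

/-! ## §1 The explicit collar identity for the pair -/

/-- **`torusCov = E_T[h_x h_y]`** for two sites of torus sup-separation `≥ 2R+4` (`1 ≤ R`, `4R+8 ≤ L`), `h_w` the collared density over the
centred cube of side `2R+3`. [folklore] -/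
theorem torusCov_eq_torusE_collar (β : ℝ) {L R : ℕ} (hR : 1 ≤ R) (hRL : 4 * R + 8 ≤ L) (x y : Fin 4 → ℤ)
    (hxy : ∃ k : Fin 4, (2 * (R : ℤ) + 4) ≤ |((((x k - y k : ℤ) : ZMod (2 * L + 1))).valMinAbs : ℤ)|) :
    torusCov G r β L x y =
      torusE G r β L (fun η =>
        (kerE G r β (fun k => x k - (R + 1)) (2 * R + 3) η (dens G r x) - torusE G r β L (dens G r x)) *
        (kerE G r β (fun k => y k - (R + 1)) (2 * R + 3) η (dens G r y) - torusE G r β L (dens G r y))) := by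
  haveI : SecondCountableTopology G :=
    (r.continuous.isClosedEmbedding r.injective).isEmbedding.secondCountableTopology
  obtain ⟨CA, hCA⟩ := r.curvature.bounded
  set v : Fin 2 → (Fin 4 → ℤ) := ![x, y] with hv
  have flip : ∀ {u w : Fin 4 → ℤ}, (∃ k : Fin 4, (2 * (R : ℤ) + 4) ≤
      |((((u k - w k : ℤ) : ZMod (2 * L + 1))).valMinAbs : ℤ)|) →
      ∃ k : Fin 4, (2 * (R : ℤ) + 4) ≤ |((((w k - u k : ℤ) : ZMod (2 * L + 1))).valMinAbs : ℤ)| := by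
    rintro u w ⟨k, hk⟩
    refine ⟨k, ?_⟩
    have e : ((w k - u k : ℤ) : ZMod (2 * L + 1)) = -((u k - w k : ℤ) : ZMod (2 * L + 1)) := by push_cast; ring
    rwa [e, Int.abs_eq_natAbs, ZMod.natAbs_valMinAbs_neg, ← Int.abs_eq_natAbs]
  have hsep : ∀ i j : Fin 2, i ≠ j → ∃ k : Fin 4,
      (2 * (R : ℤ) + 4) ≤ |((((v i k - v j k : ℤ) : ZMod (2 * L + 1))).valMinAbs : ℤ)| := by
    intro i j hij
    fin_cases i <;> fin_cases j
    · exact absurd rfl hij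
    · simpa [hv] using hxy
    · simpa [hv] using flip hxy
    · exact absurd rfl hij
  have hAc : ∀ i : Fin 2, Continuous (dens G r (v i)) := fun i => continuous_dens r (v i)
  have hAb : ∀ (i : Fin 2) (U : LGConfig 4 G), |dens G r (v i) U| ≤ CA := fun i U => hCA _
  have hAS : ∀ i : Fin 2, IsCylinder (dens G r (v i)) (OSLegsFromFemtoAndGap.DlrCollarTransfer.cubeEdges (fun k => v i k - (R + 1)) (2 * R + 3)) :=
    fun i => isCylinder_dens_cube r hR (v i)
  have hinj : ∀ i : Fin 2, Set.InjOn (Torus.proj (2 * L + 1))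
      (((OSLegsFromFemtoAndGap.DlrCollarTransfer.cubeEdges (fun k => v i k - (R + 1)) (2 * R + 3) ∪
          OSLegsFromFemtoAndGap.DlrCollarTransfer.cubeEdges (fun k => v i k - (R + 1)) (2 * R + 3) ∪
          (plaquettesTouching (OSLegsFromFemtoAndGap.DlrCollarTransfer.cubeEdges (fun k => v i k - (R + 1)) (2 * R + 3))).biUnion plaquetteEdges).image
          Prod.fst : Set (Fin 4 → ℤ))) := fun i => injOn_torusProj_cube hRL (v i)
  have hfar : ∀ i j : Fin 2, i ≠ j → ∀ e ∈ OSLegsFromFemtoAndGap.DlrCollarTransfer.cubeEdges (fun k => v j k - (R + 1)) (2 * R + 3) ∪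
      (plaquettesTouching (OSLegsFromFemtoAndGap.DlrCollarTransfer.cubeEdges (fun k => v j k - (R + 1)) (2 * R + 3))).biUnion
        plaquetteEdges,
      ∀ e' ∈ OSLegsFromFemtoAndGap.DlrCollarTransfer.cubeEdges (fun k => v i k - (R + 1)) (2 * R + 3),
      torusEdge (2 * L + 1) e ≠ torusEdge (2 * L + 1) e' :=
    fun i j hij e he e' he' => torusEdge_ne_cube (hsep i j hij) he he'
  -- covariance = centred second moment
  have h2 := torusMoment_two (G := G) r β L v
  have hv0 : v 0 = x := by simp [hv]
  have hv1 : v 1 = y := by simp [hv]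
  rw [hv0, hv1] at h2
  have hcov : torusCov G r β L x y = torusMoment r.ρ β L r.curvature.F (wilsonTorusMean r.ρ β L r.curvature.F) v := by
    rw [h2]; unfold torusCov; rfl
  rw [hcov]
  -- the explicit collar identity with the common constant `⟨dens⟩_T`
  have key := integral_prod_collar_eq (d := 4) r.ρ r.continuous β (L := 2 * L + 1) (n := 2)
    (fun i => OSLegsFromFemtoAndGap.DlrCollarTransfer.cubeEdges (fun k => v i k - (R + 1)) (2 * R + 3))
    (fun i => OSLegsFromFemtoAndGap.DlrCollarTransfer.cubeEdges (fun k => v i k - (R + 1)) (2 * R + 3))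
    (fun i => dens G r (v i)) hAc hAb hAS hinj hfar
    (fun i η => kerE G r β (fun k => v i k - (R + 1)) (2 * R + 3) η (dens G r (v i))) (fun i η => rfl)
    (fun _ => wilsonTorusMean r.ρ β L r.curvature.F)
  have hdens : ∀ (i : Fin 2) (U : LGConfig 4 G), r.curvature.F (configShift (-(v i)) U) = dens G r (v i) U :=
    fun i U => rfl
  rw [torusE_dens_eq_wilsonTorusMean (G := G) r β L x, torusE_dens_eq_wilsonTorusMean (G := G) r β L y]
  unfold torusMoment
  simp only [hdens]
  rw [← key]
  unfold torusE
  simp only [Fin.prod_univ_two, hv0, hv1]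

/-! ## §2 The pair covariance at a separated pair: collars, then clustering -/

/-- **Collar first, cluster second, for the pair.**  FBL at `β` (cubes `b·aβ ≤ ℓ₁`) and the clustering inequality at `(β, L)` give, for
`x, y` separated by `≥ n + 2R + 4` in one coordinate `k` (`1 ≤ R`, `(2R+3)·aβ ≤ ℓ₁`, `4R+8 ≤ L`):
`|torusCov β L x y| ≤ K·(2C₁/R⁴)²·e^{−m·aβ·n}`. [folklore] -/
theorem abs_torusCov_le_of_collar_cluster (β : ℝ) {aβ C₁ ℓ₁ p : ℝ} (hC₁ : 0 ≤ C₁)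
    (hF : ∀ (c : Fin 4 → ℤ) (b : ℕ), (b : ℝ) * aβ ≤ ℓ₁ → ∀ (η : LGConfig 4 G) (w : Fin 4 → ℤ),
      2 ≤ depth c b w → |kerE G r β c b η (dens G r w) - p| ≤ C₁ / (depth c b w : ℝ) ^ 4)
    {L R : ℕ} (hR : 1 ≤ R) (hb : ((2 * R + 3 : ℕ) : ℝ) * aβ ≤ ℓ₁) (hRL : 4 * R + 8 ≤ L)
    {m K : ℝ}
    (hCl : ∀ (P Q : LGConfig 4 G → ℝ) (SP SQ : Finset (Literature.MathematicalPhysics.QuantumLattice.ZdEdge 4))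
      (CP CQ : ℝ), Continuous P → Continuous Q → IsCylinder P SP → IsCylinder Q SQ →
      (∀ U, |P U| ≤ CP) → (∀ U, |Q U| ≤ CQ) → ∀ (k : Fin 4) (n : ℕ),
      (∀ e ∈ SP, ∀ e' ∈ SQ, (n : ℤ) ≤ |((((e.1 k - e'.1 k : ℤ) : ZMod (2 * L + 1))).valMinAbs : ℤ)|) →
      |torusE G r β L (fun U => P U * Q U) - torusE G r β L P * torusE G r β L Q| ≤
        K * CP * CQ * Real.exp (-(m * aβ * n)))
    (x y : Fin 4 → ℤ) (k : Fin 4) (n : ℕ)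
    (hnxy : (n : ℤ) + 2 * R + 4 ≤ |((((x k - y k : ℤ) : ZMod (2 * L + 1))).valMinAbs : ℤ)|) :
    |torusCov G r β L x y| ≤ K * (2 * C₁ / (R : ℝ) ^ 4) ^ 2 * Real.exp (-(m * aβ * n)) := by
  have hxy : ∃ k : Fin 4, (2 * (R : ℤ) + 4) ≤ |((((x k - y k : ℤ) : ZMod (2 * L + 1))).valMinAbs : ℤ)| :=
    ⟨k, le_trans (by have := Nat.cast_nonneg (α := ℤ) n; linarith) hnxy⟩
  set hx : LGConfig 4 G → ℝ := fun η =>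
    kerE G r β (fun k => x k - (R + 1)) (2 * R + 3) η (dens G r x) - torusE G r β L (dens G r x) with hhx
  set hy : LGConfig 4 G → ℝ := fun η =>
    kerE G r β (fun k => y k - (R + 1)) (2 * R + 3) η (dens G r y) - torusE G r β L (dens G r y) with hhy
  set ε : ℝ := 2 * C₁ / (R : ℝ) ^ 4 with hε
  have hε0 : 0 ≤ ε := by positivity
  have hbx : ∀ η, |hx η| ≤ ε := fun η => abs_collar_le G r β hC₁ hF hR hb hRL x η
  have hby : ∀ η, |hy η| ≤ ε := fun η => abs_collar_le G r β hC₁ hF hR hb hRL y η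
  have hid : torusCov G r β L x y = torusE G r β L (fun η => hx η * hy η) := by
    rw [torusCov_eq_torusE_collar G r β hR hRL x y hxy]
  set SX := OSLegsFromFemtoAndGap.DlrCollarTransfer.cubeEdges (fun k => x k - (R + 1)) (2 * R + 3) ∪
    (plaquettesTouching (OSLegsFromFemtoAndGap.DlrCollarTransfer.cubeEdges (fun k => x k - (R + 1)) (2 * R + 3))).biUnion
      plaquetteEdges with hSX
  set SY := OSLegsFromFemtoAndGap.DlrCollarTransfer.cubeEdges (fun k => y k - (R + 1)) (2 * R + 3) ∪
    (plaquettesTouching (OSLegsFromFemtoAndGap.DlrCollarTransfer.cubeEdges (fun k => y k - (R + 1)) (2 * R + 3))).biUnion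
      plaquetteEdges with hSY
  have hcx : IsCylinder hx SX := isCylinder_collar G r β L R hR x
  have hcy : IsCylinder hy SY := isCylinder_collar G r β L R hR y
  have hPc : Continuous hx := continuous_collar G r β L R x
  have hQc : Continuous hy := continuous_collar G r β L R y
  have hsep : ∀ e ∈ SX, ∀ e' ∈ SY,
      (n : ℤ) ≤ |((((e.1 k - e'.1 k : ℤ) : ZMod (2 * L + 1))).valMinAbs : ℤ)| := fun e he e' he' =>
    le_abs_valMinAbs_of_near L hnxy (near_of_mem_collarSupport he k) (near_of_mem_collarSupport he' k)
  have hcl := hCl hx hy SX SY ε ε hPc hQc hcx hcy hbx hby k n hsep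
  have h0 : torusE G r β L hx = 0 := torusE_collar_eq_zero G r β hR hRL x
  rw [h0, zero_mul, sub_zero] at hcl
  rw [hid]
  calc |torusE G r β L (fun η => hx η * hy η)| ≤ K * ε * ε * Real.exp (-(m * aβ * n)) := hcl
    _ = K * ε ^ 2 * Real.exp (-(m * aβ * n)) := by ring

/-! ## §3 Hyperscaling clustering from FBL and clustering -/

/-- Some coordinate carries at least half of the torus distance. [folklore] -/
theorem exists_coord_half_le_valMinAbs (L : ℕ) (x y : Fin 4 → ℤ) :
    ∃ k : Fin 4, RunningCouplingCeiling.Pointwise.torusDist L x y / 2 ≤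
      (|((((x k - y k : ℤ) : ZMod (2 * L + 1))).valMinAbs : ℤ)| : ℝ) := by
  set f : Fin 4 → ℝ := fun k => ((((x k - y k : ℤ) : ZMod (2 * L + 1))).valMinAbs : ℤ) with hf
  have hsum : RunningCouplingCeiling.Pointwise.torusDist L x y ^ 2 = ∑ k : Fin 4, f k ^ 2 := by
    unfold RunningCouplingCeiling.Pointwise.torusDist
    rw [Real.sq_sqrt (Finset.sum_nonneg fun k _ => sq_nonneg _)]
  have h4 : ∑ _k : Fin 4, (RunningCouplingCeiling.Pointwise.torusDist L x y / 2) ^ 2 =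
      RunningCouplingCeiling.Pointwise.torusDist L x y ^ 2 := by
    rw [Finset.sum_const, Finset.card_univ, Fintype.card_fin]; ring
  obtain ⟨k, -, hk⟩ := Finset.exists_le_of_sum_le (Finset.univ_nonempty (α := Fin 4))
    (f := fun _ => (RunningCouplingCeiling.Pointwise.torusDist L x y / 2) ^ 2) (g := fun k => f k ^ 2) (by rw [h4, hsum])
  refine ⟨k, ?_⟩
  have hk' : (RunningCouplingCeiling.Pointwise.torusDist L x y / 2) ^ 2 ≤ |f k| ^ 2 := by rwa [sq_abs]
  have hd : 0 ≤ RunningCouplingCeiling.Pointwise.torusDist L x y / 2 := by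
    have : 0 ≤ RunningCouplingCeiling.Pointwise.torusDist L x y := Real.sqrt_nonneg _
    linarith
  have h := (pow_le_pow_iff_left₀ hd (abs_nonneg (f k)) two_ne_zero).1 hk'
  simpa [hf, Int.cast_abs] using h

/-- The polynomial-times-exponential envelope tends to zero: eventually `C·s⁸·e^{−(m/2)s} ≤ ε`. [folklore] -/
theorem eventually_pow_mul_exp_le {m C ε : ℝ} (hm : 0 < m) (hε : 0 < ε) :
    ∃ D : ℝ, ∀ s : ℝ, D ≤ s → C * (s ^ 8 * Real.exp (-(m / 2 * s))) ≤ ε := by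
  have hm2 : 0 < m / 2 := by positivity
  have h1 : Tendsto (fun s : ℝ => (m / 2 * s) ^ 8 * Real.exp (-(m / 2 * s))) atTop (𝓝 0) :=
    (Real.tendsto_pow_mul_exp_neg_atTop_nhds_zero 8).comp (tendsto_id.const_mul_atTop hm2)
  have h2 : Tendsto (fun s : ℝ => C * (2 / m) ^ 8 * ((m / 2 * s) ^ 8 * Real.exp (-(m / 2 * s)))) atTop (𝓝 0) := by
    simpa using h1.const_mul (C * (2 / m) ^ 8)
  have h3 : ∀ s : ℝ, C * (s ^ 8 * Real.exp (-(m / 2 * s))) = C * (2 / m) ^ 8 * ((m / 2 * s) ^ 8 * Real.exp (-(m / 2 * s))) := by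
    intro s
    have h4 : (2 / m) ^ 8 * (m / 2 * s) ^ 8 = s ^ 8 := by
      rw [← mul_pow]; congr 1; field_simp
    calc C * (s ^ 8 * Real.exp (-(m / 2 * s))) = C * ((2 / m) ^ 8 * (m / 2 * s) ^ 8 * Real.exp (-(m / 2 * s))) := by
          rw [h4]
      _ = _ := by ring
  obtain ⟨D, hD⟩ := Filter.eventually_atTop.1 (h2.eventually (Iic_mem_nhds hε))
  exact ⟨D, fun s hs => by rw [h3]; exact hD s hs⟩

/-- **Hyperscaling clustering from the femto boundary law and gap-class torus clustering** in the same unit `u`. [folklore] -/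
theorem hyperscalingClustering_of_fbl_clustering {u : ℝ → ℝ} (hu : ∀ β, 0 < u β) (hu0 : Tendsto u atTop (𝓝 0))
    (hF : FBL G r u)
    (hCl : ∃ m K β₀ Λ₀ : ℝ, 0 < m ∧ 0 ≤ K ∧ ∀ β : ℝ, β₀ ≤ β → ∀ L : ℕ, Λ₀ ≤ u β * L →
      ∀ (P Q : LGConfig 4 G → ℝ) (SP SQ : Finset (Literature.MathematicalPhysics.QuantumLattice.ZdEdge 4))
        (CP CQ : ℝ), Continuous P → Continuous Q → IsCylinder P SP → IsCylinder Q SQ →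
        (∀ U, |P U| ≤ CP) → (∀ U, |Q U| ≤ CQ) → ∀ (k : Fin 4) (n : ℕ),
        (∀ e ∈ SP, ∀ e' ∈ SQ, (n : ℤ) ≤ |((((e.1 k - e'.1 k : ℤ) : ZMod (2 * L + 1))).valMinAbs : ℤ)|) →
        |torusE G r β L (fun U => P U * Q U) - torusE G r β L P * torusE G r β L Q| ≤
          K * CP * CQ * Real.exp (-(m * u β * n))) :
    HyperscalingClustering G r u := by
  obtain ⟨C₁, β₁, ℓ₁, p, hℓ₁, hC₁, HF⟩ := hF
  obtain ⟨m, K, β₂, Λ₂, hm, hK, HCl⟩ := hCl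
  intro ε hε
  -- the envelope constant and the physical distance `D`
  set K₀ : ℝ := K * (2 * C₁) ^ 2 * (16 / ℓ₁) ^ 8 * Real.exp (m * (ℓ₁ / 4 + 5)) with hK₀
  have hK₀0 : 0 ≤ K₀ := by positivity
  obtain ⟨D₁, hD₁⟩ := eventually_pow_mul_exp_le (C := K₀) hm hε
  set D : ℝ := max D₁ (ℓ₁ / 2 + 10) with hD
  -- thresholds in β: FBL, clustering, `uβ ≤ min 1 (ℓ₁/16)`
  have hsmall : ∀ᶠ β in atTop, u β ≤ min 1 (ℓ₁ / 16) := by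
    have h1 : (0 : ℝ) < min 1 (ℓ₁ / 16) := lt_min one_pos (by positivity)
    exact (hu0.eventually (Iic_mem_nhds h1)).mono fun β h => h
  obtain ⟨β₃, hβ₃⟩ := Filter.eventually_atTop.1 hsmall
  refine ⟨D, max (max β₁ β₂) β₃, max Λ₂ (ℓ₁ + 9), fun β hβ L hL x hx y hy hDd => ?_⟩
  have hβ₁ : β₁ ≤ β := ((le_max_left _ _).trans (le_max_left _ _)).trans hβ
  have hβ₂ : β₂ ≤ β := ((le_max_right _ _).trans (le_max_left _ _)).trans hβ
  have hus := hβ₃ β ((le_max_right _ _).trans hβ)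
  have hu1 : u β ≤ 1 := hus.trans (min_le_left _ _)
  have huℓ : u β ≤ ℓ₁ / 16 := hus.trans (min_le_right _ _)
  have huβ := hu β
  have hLΛ : Λ₂ ≤ u β * L := (le_max_left _ _).trans hL
  have hLℓ : ℓ₁ + 9 ≤ u β * L := (le_max_right _ _).trans hL
  set d : ℝ := RunningCouplingCeiling.Pointwise.torusDist L x y with hdd
  have hDD₁ : D₁ ≤ D := le_max_left _ _
  have hDℓ : ℓ₁ / 2 + 10 ≤ D := le_max_right _ _
  have hD0 : 0 < D := lt_of_lt_of_le (by positivity) hDℓ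
  have hs : D ≤ u β * d := hDd
  have hd0 : 0 < d := by
    by_contra hneg
    have : u β * d ≤ 0 := mul_nonpos_of_nonneg_of_nonpos huβ.le (not_lt.mp hneg)
    linarith
  -- the collar radius `R = ⌊ℓ₁/(8uβ)⌋`
  set R : ℕ := ⌊ℓ₁ / (8 * u β)⌋₊ with hRdef
  have hRle : (R : ℝ) ≤ ℓ₁ / (8 * u β) := Nat.floor_le (by positivity)
  have hRge : ℓ₁ / (8 * u β) - 1 ≤ (R : ℝ) := by
    have := Nat.lt_floor_add_one (ℓ₁ / (8 * u β)); linarith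
  have h2le : (2 : ℝ) ≤ ℓ₁ / (8 * u β) := by
    rw [le_div_iff₀ (by positivity)]; linarith
  have hR1 : 1 ≤ R := by
    have h1 : (1 : ℝ) ≤ R := by linarith
    exact_mod_cast h1
  have hRpos : (0 : ℝ) < R := by
    have h1 : (1 : ℝ) ≤ R := by exact_mod_cast hR1
    linarith
  have hRlow : ℓ₁ / (16 * u β) ≤ (R : ℝ) := by
    have h1 : ℓ₁ / (16 * u β) = ℓ₁ / (8 * u β) / 2 := by field_simp; ring
    rw [h1]; linarith
  have h8 : 0 < 8 * u β := by positivity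
  have hR8 : (R : ℝ) * (8 * u β) ≤ ℓ₁ := by
    have h := hRle; rw [le_div_iff₀ h8] at h; exact h
  have hb : ((2 * R + 3 : ℕ) : ℝ) * u β ≤ ℓ₁ := by
    push_cast
    have h1 : (2 * (R : ℝ) + 3) * u β = (R : ℝ) * (8 * u β) / 4 + 3 * u β := by ring
    rw [h1]; linarith
  have hRL : 4 * R + 8 ≤ L := by
    have h1 : (4 * (R : ℝ) + 8) * u β ≤ (L : ℝ) * u β := by
      have h2 : (4 * (R : ℝ) + 8) * u β = (R : ℝ) * (8 * u β) / 2 + 8 * u β := by ring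
      have h3 : (L : ℝ) * u β = u β * L := mul_comm _ _
      rw [h2, h3]; linarith
    have h3 : (4 * (R : ℝ) + 8) ≤ L := le_of_mul_le_mul_right h1 huβ
    exact_mod_cast h3
  -- the separating coordinate and the gap `n`
  obtain ⟨k, hk⟩ := exists_coord_half_le_valMinAbs L x y
  rw [← hdd] at hk
  have hd2 : 2 * (R : ℝ) + 5 ≤ d / 2 := by
    have h1 : D / u β ≤ d := by rw [div_le_iff₀ huβ]; linarith
    have h2 : (ℓ₁ / 2 + 10) / u β ≤ d := le_trans (div_le_div_of_nonneg_right hDℓ huβ.le) h1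
    have h3 : ℓ₁ / (4 * u β) + 5 ≤ d / 2 := by
      have h4 : (ℓ₁ / 2 + 10) / u β = 2 * (ℓ₁ / (4 * u β)) + 10 / u β := by field_simp; ring
      have h5 : 10 ≤ 10 / u β := by rw [le_div_iff₀ huβ]; linarith
      linarith
    have h6 : 2 * (R : ℝ) ≤ ℓ₁ / (4 * u β) := by
      have h7 : ℓ₁ / (4 * u β) = 2 * (ℓ₁ / (8 * u β)) := by field_simp; ring
      rw [h7]; linarith
    linarith
  set n : ℕ := ⌊d / 2⌋₊ - (2 * R + 4) with hndef
  have hfloor_le : (⌊d / 2⌋₊ : ℝ) ≤ d / 2 := Nat.floor_le (by positivity)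
  have hfloor_ge : d / 2 - 1 ≤ (⌊d / 2⌋₊ : ℝ) := by have := Nat.lt_floor_add_one (d / 2); linarith
  have hnat : 2 * R + 4 ≤ ⌊d / 2⌋₊ := by
    have h1 : (2 * (R : ℝ) + 4) ≤ ⌊d / 2⌋₊ := by linarith
    exact_mod_cast h1
  have hn_real : (n : ℝ) = ⌊d / 2⌋₊ - (2 * R + 4) := by
    rw [hndef, Nat.cast_sub hnat]; push_cast; ring
  have hnxy : (n : ℤ) + 2 * R + 4 ≤ |((((x k - y k : ℤ) : ZMod (2 * L + 1))).valMinAbs : ℤ)| := by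
    have h1 : ((n : ℤ) + 2 * R + 4 : ℤ) = (⌊d / 2⌋₊ : ℤ) := by
      have := Nat.cast_sub (R := ℤ) hnat; push_cast at this ⊢; omega
    rw [h1]
    have h2 : ((⌊d / 2⌋₊ : ℕ) : ℝ) ≤ (|((((x k - y k : ℤ) : ZMod (2 * L + 1))).valMinAbs : ℤ)| : ℝ) :=
      hfloor_le.trans hk
    exact_mod_cast h2
  -- collars, then clustering at `(β, L)`
  have hpair := abs_torusCov_le_of_collar_cluster G r β hC₁ (HF β hβ₁) hR1 hb hRL (HCl β hβ₂ L hLΛ) x y k n hnxy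
  -- the envelope
  have hexp : Real.exp (-(m * u β * n)) ≤ Real.exp (m * (ℓ₁ / 4 + 5)) * Real.exp (-(m / 2 * (u β * d))) := by
    rw [← Real.exp_add]
    apply Real.exp_le_exp.2
    have h1 : u β * d / 2 - ℓ₁ / 4 - 5 ≤ u β * n := by
      rw [hn_real]
      have h2 : u β * (d / 2 - 1 - (2 * R + 4)) ≤ u β * ((⌊d / 2⌋₊ : ℝ) - (2 * R + 4)) :=
        mul_le_mul_of_nonneg_left (by linarith) huβ.le
      have h3 : u β * (d / 2 - 1 - (2 * R + 4)) = u β * d / 2 - (R : ℝ) * (8 * u β) / 4 - 5 * u β := by ring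
      rw [h3] at h2
      linarith
    have h5 := mul_le_mul_of_nonneg_left h1 hm.le
    have h6 : m * (u β * d / 2 - ℓ₁ / 4 - 5) = -(m * (ℓ₁ / 4 + 5)) + m / 2 * (u β * d) := by ring
    have h7 : m * (u β * ↑n) = m * u β * ↑n := by ring
    rw [h6] at h5; rw [h7] at h5
    linarith
  have hRpow : (2 * C₁ / (R : ℝ) ^ 4) ^ 2 ≤ (2 * C₁) ^ 2 * (16 * u β / ℓ₁) ^ 8 := by
    have h1 : 2 * C₁ / (R : ℝ) ^ 4 ≤ 2 * C₁ * (16 * u β / ℓ₁) ^ 4 := by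
      rw [div_le_iff₀ (by positivity)]
      have h2 : 1 ≤ (16 * u β / ℓ₁) ^ 4 * (R : ℝ) ^ 4 := by
        rw [← mul_pow]
        have h3 : 1 ≤ 16 * u β / ℓ₁ * R := by
          have := mul_le_mul_of_nonneg_left hRlow (by positivity : (0 : ℝ) ≤ 16 * u β / ℓ₁)
          have h4 : 16 * u β / ℓ₁ * (ℓ₁ / (16 * u β)) = 1 := by field_simp
          linarith
        exact one_le_pow₀ h3
      calc 2 * C₁ = 2 * C₁ * 1 := (mul_one _).symm
        _ ≤ 2 * C₁ * ((16 * u β / ℓ₁) ^ 4 * (R : ℝ) ^ 4) := mul_le_mul_of_nonneg_left h2 (by positivity)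
        _ = 2 * C₁ * (16 * u β / ℓ₁) ^ 4 * (R : ℝ) ^ 4 := by ring
    calc (2 * C₁ / (R : ℝ) ^ 4) ^ 2 ≤ (2 * C₁ * (16 * u β / ℓ₁) ^ 4) ^ 2 := pow_le_pow_left₀ (by positivity) h1 2
      _ = (2 * C₁) ^ 2 * (16 * u β / ℓ₁) ^ 8 := by ring
  have hmain : d ^ 8 * |torusCov G r β L x y| ≤ K₀ * ((u β * d) ^ 8 * Real.exp (-(m / 2 * (u β * d)))) := by
    calc d ^ 8 * |torusCov G r β L x y|
        ≤ d ^ 8 * (K * (2 * C₁ / (R : ℝ) ^ 4) ^ 2 * Real.exp (-(m * u β * n))) :=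
          mul_le_mul_of_nonneg_left hpair (by positivity)
      _ ≤ d ^ 8 * (K * ((2 * C₁) ^ 2 * (16 * u β / ℓ₁) ^ 8) *
            (Real.exp (m * (ℓ₁ / 4 + 5)) * Real.exp (-(m / 2 * (u β * d))))) := by
          apply mul_le_mul_of_nonneg_left _ (by positivity)
          exact mul_le_mul (mul_le_mul_of_nonneg_left hRpow hK) hexp (by positivity) (by positivity)
      _ = K₀ * ((u β * d) ^ 8 * Real.exp (-(m / 2 * (u β * d)))) := by
          rw [hK₀]; ring
  exact hmain.trans (hD₁ _ (hDD₁.trans hs))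

/-! ## §4 The Sig-level certificate: engine ∧ gap-class clustering in ONE unit -/

omit [MeasurableSpace G] [BorelSpace G] in
/-- **Engine laws and gap-class torus clustering in ONE unit per `(G, r)` imply the registered interface** `FemtoEngineSigR`
(hence both cruxes and, with the residual, `NT`).  Nothing of the hypotheses is proved. [folklore] -/
theorem femtoEngineSigR_of_engine_clustering
    (h : ∀ (G : Type) [Group G] [TopologicalSpace G] [IsTopologicalGroup G] [CompactSpace G],
      IsCompactSimpleLieGroup G →
      letI : MeasurableSpace G := borel G
      haveI : BorelSpace G := ⟨rfl⟩
      ∀ (r : LatticeRep G), ∃ u : ℝ → ℝ, (∀ β, 0 < u β) ∧ Filter.Tendsto u Filter.atTop (nhds 0) ∧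
        FemtoEngineAt G r u ∧
        (∃ m K β₀ Λ₀ : ℝ, 0 < m ∧ 0 ≤ K ∧ ∀ β : ℝ, β₀ ≤ β → ∀ L : ℕ, Λ₀ ≤ u β * L →
          ∀ (P Q : LGConfig 4 G → ℝ) (SP SQ : Finset (Literature.MathematicalPhysics.QuantumLattice.ZdEdge 4))
            (CP CQ : ℝ), Continuous P → Continuous Q → IsCylinder P SP → IsCylinder Q SQ →
            (∀ U, |P U| ≤ CP) → (∀ U, |Q U| ≤ CQ) → ∀ (k : Fin 4) (n : ℕ),
            (∀ e ∈ SP, ∀ e' ∈ SQ, (n : ℤ) ≤ |((((e.1 k - e'.1 k : ℤ) : ZMod (2 * L + 1))).valMinAbs : ℤ)|) →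
            |torusE G r β L (fun U => P U * Q U) - torusE G r β L P * torusE G r β L Q| ≤
              K * CP * CQ * Real.exp (-(m * u β * n)))) :
    FemtoEngineSigR := by
  apply femtoEngineSigR_of_hc
  intro G _ _ _ _ hG
  letI : MeasurableSpace G := borel G
  haveI : BorelSpace G := ⟨rfl⟩
  intro r
  obtain ⟨u, hu, hu0, hE, hCl⟩ := h G hG r
  refine ⟨u, hu, hu0, hE, ?_⟩
  obtain ⟨D, C₁, β₁, ℓ₁, hℓ₁, H⟩ := hE.1
  have hF6 : FBL6 G r u := fbl6_of_oscillation G r u hu D ⟨C₁, β₁, ℓ₁, hℓ₁, H⟩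
  exact hyperscalingClustering_of_fbl_clustering G r hu hu0 (fbl_of_fbl6 r u hF6) hCl

end Summit.QuantumFields.YangMills.Cruxes.ResponseLocalisation.FemtoEngine

end
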